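import Summits.HodgeConjecture.CorCM.GaloisCyclicSemidirectEightNormPairIff
import Summits.HodgeConjecture.CorCM.GaloisCyclicSemidirectTwoPowerAllTypes
import HarnessLib

/-!
# `C_p ⋊ C₈` without `μ₄`-norm pairs: EVERY abelian variety with CM by the field is stably nondegenerate (all types, all powers)

COR-CM (cell `pub-hodgecm2`), binder seat b04 (gen 29), count-neutral claim CYCLIC-SEMIDIRECT-EIGHT-DEGENERATE, part VIIId — the
ALL-TYPES upgrade of part VIIIc (`CorCM/GaloisCyclicSemidirectEightNormPairIff`) through gen 21's engine (case `a = 1` of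
`CorCM/GaloisCyclicSemidirectTwoPowerAllTypes`).  KERNEL ONLY: theorems; no definition, no named fact, no `sorry`.  `HC_CM` is
neither used nor claimed.

`K` a Galois CM field with `Gal(K/ℚ) ≅ C_p ⋊ C₈` (`p` an odd prime, `φ(1)` = inversion) such that `ℤ/p` carries NO `μ₄`-norm
pair with non-constant first sheet (`hNP`, the combinatorial hypothesis of part VIIIc; it holds for every `p ≡ 5 (mod 8)` and is
refuted by explicit pairs for `p = 3, 7, 11, 17, 19, 23, 31, 41, 71, 73, 89, 127`).  Then:
* `isStablyNondegenerate_of_ringHom_of_forall_normPair_const`: every complex abelian variety `X` with `K ↪ End⁰(X)`,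
  `[K:ℚ] = 2 dim X` (dimension `4p`), is STABLY NONDEGENERATE;
* `hodgeConjectureFor_of_isIsogenous_powSucc_of_forall_normPair_const`: the Hodge conjecture for everything isogenous to a
  power of such an `X`;
* `isStablyNondegenerate_of_isCMTypeRealisation_of_forall_normPair_const`, **`hodgeConjectureFor_pow_of_forall_normPair_const`**:
  the HODGE CONJECTURE FOR EVERY POWER OF EVERY ABELIAN VARIETY OF ANY CM TYPE `(K; Φ)` — no simplicity hypothesis.

## References

* [Shimura1998] G. Shimura, *Abelian Varieties with Complex Multiplication and Modular Functions*, §5.1 Prop. 3, §8.2 Prop. 26.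
* [Gordon1999HodgeAVSurvey] B. B. Gordon, *A survey of the Hodge conjecture for abelian varieties*, Thm. 6.3–6.4, Def. 7.6.
-/

noncomputable section

open CategoryTheory CategoryTheory.Limits NumberField

namespace Summit.HodgeConjecture.CorCM.GaloisCyclicSemidirectEight

open Literature.NumberTheory.ComplexMultiplication
open Literature.AlgebraicGeometry Literature.AlgebraicGeometry.Motives Literature.AlgebraicGeometry.HodgeTheory
open Literature.AlgebraicGeometry.Motives.AbelianVariety
open Literature.AlgebraicGeometry.ComplexMultiplication
open Literature.AlgebraicGeometry.Pohlmann1968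
open Summit.HodgeConjecture.CorCM.GaloisRank

section Field

variable {p : ℕ} [Fact p.Prime]
variable {K : Type} [Field K] [NumberField K] [IsCMField K] [IsGalois ℚ K]

/-- **ALL TYPES under the no-norm-pair hypothesis.**  `Gal(K/ℚ) ≅ C_p ⋊ C₈` (`p` an odd prime, `φ(1)` = inversion) and `ℤ/p`
carries no `μ₄`-norm pair with non-constant first sheet (`hNP`): then EVERY complex abelian variety `X` with `ψ : K →+* End⁰(X)`
and `[K:ℚ] = 2 dim X` is STABLY NONDEGENERATE — the case `a = 1` of gen 21's engine
`GaloisCyclicSemidirectTwoPower.isStablyNondegenerate_of_ringHom_cyclicSemidirect` fed with part VIIIc's nondegeneracy of all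
primitive types. [cite: Shimura1998, §5.1 Prop. 3, §8.2 Prop. 26] [cite: Gordon1999HodgeAVSurvey, Thm. 6.4 and Def. 7.6] -/
theorem isStablyNondegenerate_of_ringHom_of_forall_normPair_const (hp2 : p ≠ 2)
    (φ : Multiplicative (ZMod 8) →* MulAut (Multiplicative (ZMod p)))
    (hφ : ∀ v : Multiplicative (ZMod p), φ (Multiplicative.ofAdd 1) v = v⁻¹)
    (hNP : ∀ k₀ k₁ : ZMod p → ZMod 4,
      (∀ d : ZMod p,
        (Finset.univ.filter fun v => k₀ v + k₀ (v - d) = 0).card +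
              (Finset.univ.filter fun v => k₁ v + k₁ (v - d) = 1).card +
            (Finset.univ.filter fun v => k₀ v + k₀ v = 2).card + (Finset.univ.filter fun v => k₁ v + k₁ v = 3).card =
          (Finset.univ.filter fun v => k₀ v + k₀ v = 0).card + (Finset.univ.filter fun v => k₁ v + k₁ v = 1).card +
              (Finset.univ.filter fun v => k₀ v + k₀ (v - d) = 2).card +
            (Finset.univ.filter fun v => k₁ v + k₁ (v - d) = 3).card) →
      (∀ d : ZMod p,
        (Finset.univ.filter fun v => k₀ v + k₀ (v - d) = 1).card +
              (Finset.univ.filter fun v => k₁ v + k₁ (v - d) = 2).card +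
            (Finset.univ.filter fun v => k₀ v + k₀ v = 3).card + (Finset.univ.filter fun v => k₁ v + k₁ v = 0).card =
          (Finset.univ.filter fun v => k₀ v + k₀ v = 1).card + (Finset.univ.filter fun v => k₁ v + k₁ v = 2).card +
              (Finset.univ.filter fun v => k₀ v + k₀ (v - d) = 3).card +
            (Finset.univ.filter fun v => k₁ v + k₁ (v - d) = 0).card) →
      ∀ v, k₀ v = k₀ 0)
    (e : (K ≃ₐ[ℚ] K) ≃* Multiplicative (ZMod p) ⋊[φ] Multiplicative (ZMod 8))
    {X : AbelianVariety ℂ} (ψ : K →+* X.endAlgebra) (hX : Module.finrank ℚ K = 2 * X.dim) : IsStablyNondegenerate X :=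
  GaloisCyclicSemidirectTwoPower.isStablyNondegenerate_of_ringHom_cyclicSemidirect (a := 1) hp2 φ hφ e
    (fun _ φ₀ hprim => isNondegenerate_of_isPrimitive_of_forall_normPair_const hp2 φ hφ hNP e φ₀ hprim) ψ hX

/-- **The Hodge conjecture for everything isogenous to a power of such an `X`** — no simplicity, under `hNP`.
[cite: Gordon1999HodgeAVSurvey, Thm. 6.3–6.4] -/
theorem hodgeConjectureFor_of_isIsogenous_powSucc_of_forall_normPair_const (hp2 : p ≠ 2)
    (φ : Multiplicative (ZMod 8) →* MulAut (Multiplicative (ZMod p)))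
    (hφ : ∀ v : Multiplicative (ZMod p), φ (Multiplicative.ofAdd 1) v = v⁻¹)
    (hNP : ∀ k₀ k₁ : ZMod p → ZMod 4,
      (∀ d : ZMod p,
        (Finset.univ.filter fun v => k₀ v + k₀ (v - d) = 0).card +
              (Finset.univ.filter fun v => k₁ v + k₁ (v - d) = 1).card +
            (Finset.univ.filter fun v => k₀ v + k₀ v = 2).card + (Finset.univ.filter fun v => k₁ v + k₁ v = 3).card =
          (Finset.univ.filter fun v => k₀ v + k₀ v = 0).card + (Finset.univ.filter fun v => k₁ v + k₁ v = 1).card +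
              (Finset.univ.filter fun v => k₀ v + k₀ (v - d) = 2).card +
            (Finset.univ.filter fun v => k₁ v + k₁ (v - d) = 3).card) →
      (∀ d : ZMod p,
        (Finset.univ.filter fun v => k₀ v + k₀ (v - d) = 1).card +
              (Finset.univ.filter fun v => k₁ v + k₁ (v - d) = 2).card +
            (Finset.univ.filter fun v => k₀ v + k₀ v = 3).card + (Finset.univ.filter fun v => k₁ v + k₁ v = 0).card =
          (Finset.univ.filter fun v => k₀ v + k₀ v = 1).card + (Finset.univ.filter fun v => k₁ v + k₁ v = 2).card +
              (Finset.univ.filter fun v => k₀ v + k₀ (v - d) = 3).card +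
            (Finset.univ.filter fun v => k₁ v + k₁ (v - d) = 0).card) →
      ∀ v, k₀ v = k₀ 0)
    (e : (K ≃ₐ[ℚ] K) ≃* Multiplicative (ZMod p) ⋊[φ] Multiplicative (ZMod 8))
    {X : AbelianVariety ℂ} (ψ : K →+* X.endAlgebra) (hX : Module.finrank ℚ K = 2 * X.dim)
    {B : AbelianVariety ℂ} {N : ℕ} (h : IsIsogenous B (X.powSucc N)) : HodgeConjectureFor B.dim B.X :=
  (isStablyNondegenerate_of_ringHom_of_forall_normPair_const hp2 φ hφ hNP e ψ hX).hodgeConjectureFor_of_isIsogenous_powSucc h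

variable {Φ : CMType K} {A : AbelianVariety ℂ} {ι : 𝓞 K →+* End A} {θ : K →+* Module.End ℂ (complexBetti A.X 1)}

/-- **Realisation form**: every abelian variety `(A, ι)` of ANY CM type `(K; Φ)` is stably nondegenerate, under `hNP`.
[cite: Shimura1998, §5.1–5.2] [cite: Gordon1999HodgeAVSurvey, Thm. 6.4] -/
theorem isStablyNondegenerate_of_isCMTypeRealisation_of_forall_normPair_const (hp2 : p ≠ 2)
    (φ : Multiplicative (ZMod 8) →* MulAut (Multiplicative (ZMod p)))
    (hφ : ∀ v : Multiplicative (ZMod p), φ (Multiplicative.ofAdd 1) v = v⁻¹)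
    (hNP : ∀ k₀ k₁ : ZMod p → ZMod 4,
      (∀ d : ZMod p,
        (Finset.univ.filter fun v => k₀ v + k₀ (v - d) = 0).card +
              (Finset.univ.filter fun v => k₁ v + k₁ (v - d) = 1).card +
            (Finset.univ.filter fun v => k₀ v + k₀ v = 2).card + (Finset.univ.filter fun v => k₁ v + k₁ v = 3).card =
          (Finset.univ.filter fun v => k₀ v + k₀ v = 0).card + (Finset.univ.filter fun v => k₁ v + k₁ v = 1).card +
              (Finset.univ.filter fun v => k₀ v + k₀ (v - d) = 2).card +
            (Finset.univ.filter fun v => k₁ v + k₁ (v - d) = 3).card) →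
      (∀ d : ZMod p,
        (Finset.univ.filter fun v => k₀ v + k₀ (v - d) = 1).card +
              (Finset.univ.filter fun v => k₁ v + k₁ (v - d) = 2).card +
            (Finset.univ.filter fun v => k₀ v + k₀ v = 3).card + (Finset.univ.filter fun v => k₁ v + k₁ v = 0).card =
          (Finset.univ.filter fun v => k₀ v + k₀ v = 1).card + (Finset.univ.filter fun v => k₁ v + k₁ v = 2).card +
              (Finset.univ.filter fun v => k₀ v + k₀ (v - d) = 3).card +
            (Finset.univ.filter fun v => k₁ v + k₁ (v - d) = 0).card) →
      ∀ v, k₀ v = k₀ 0)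
    (e : (K ≃ₐ[ℚ] K) ≃* Multiplicative (ZMod p) ⋊[φ] Multiplicative (ZMod 8))
    (hA : IsCMTypeRealisation Φ A ι θ) : IsStablyNondegenerate A := by
  obtain ⟨i, -⟩ := exists_ringHom_endAlgebra ι
  exact isStablyNondegenerate_of_ringHom_of_forall_normPair_const hp2 φ hφ hNP e i
    (finrank_eq_two_mul_dim_of_isCMTypeRealisation hA)

/-- **THE HODGE CONJECTURE FOR EVERY POWER OF EVERY ABELIAN VARIETY (any CM type, simple or not) WITH CM BY A GALOIS CM
FIELD WITH GROUP `C_p ⋊ C₈`, AS SOON AS `ℤ/p` HAS NO `μ₄`-NORM PAIR** — part VIIIc's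
`hodgeConjectureFor_pow_of_isSimple_…` WITHOUT `A.IsSimple`. [cite: Gordon1999HodgeAVSurvey, Thm. 6.4]
[cite: Shimura1998, §5.1 Prop. 3 and §8.2 Prop. 26] -/
theorem hodgeConjectureFor_pow_of_forall_normPair_const (hp2 : p ≠ 2)
    (φ : Multiplicative (ZMod 8) →* MulAut (Multiplicative (ZMod p)))
    (hφ : ∀ v : Multiplicative (ZMod p), φ (Multiplicative.ofAdd 1) v = v⁻¹)
    (hNP : ∀ k₀ k₁ : ZMod p → ZMod 4,
      (∀ d : ZMod p,
        (Finset.univ.filter fun v => k₀ v + k₀ (v - d) = 0).card +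
              (Finset.univ.filter fun v => k₁ v + k₁ (v - d) = 1).card +
            (Finset.univ.filter fun v => k₀ v + k₀ v = 2).card + (Finset.univ.filter fun v => k₁ v + k₁ v = 3).card =
          (Finset.univ.filter fun v => k₀ v + k₀ v = 0).card + (Finset.univ.filter fun v => k₁ v + k₁ v = 1).card +
              (Finset.univ.filter fun v => k₀ v + k₀ (v - d) = 2).card +
            (Finset.univ.filter fun v => k₁ v + k₁ (v - d) = 3).card) →
      (∀ d : ZMod p,
        (Finset.univ.filter fun v => k₀ v + k₀ (v - d) = 1).card +
              (Finset.univ.filter fun v => k₁ v + k₁ (v - d) = 2).card +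
            (Finset.univ.filter fun v => k₀ v + k₀ v = 3).card + (Finset.univ.filter fun v => k₁ v + k₁ v = 0).card =
          (Finset.univ.filter fun v => k₀ v + k₀ v = 1).card + (Finset.univ.filter fun v => k₁ v + k₁ v = 2).card +
              (Finset.univ.filter fun v => k₀ v + k₀ (v - d) = 3).card +
            (Finset.univ.filter fun v => k₁ v + k₁ (v - d) = 0).card) →
      ∀ v, k₀ v = k₀ 0)
    (e : (K ≃ₐ[ℚ] K) ≃* Multiplicative (ZMod p) ⋊[φ] Multiplicative (ZMod 8))
    (hA : IsCMTypeRealisation Φ A ι θ) (N : ℕ) :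
    HodgeConjectureFor (⨁ fun _ : Fin N => A).dim (⨁ fun _ : Fin N => A).X :=
  hodgeConjectureFor_of_isDivisorGenerated _
    ((isStablyNondegenerate_iff_forall_isDivisorGenerated_biproduct A).1
      (isStablyNondegenerate_of_isCMTypeRealisation_of_forall_normPair_const hp2 φ hφ hNP e hA) N)

end Field

end Summit.HodgeConjecture.CorCM.GaloisCyclicSemidirectEight

end
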